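import Literature.NumberTheory.PAdicHodge.AinfGaloisContinuity
import Literature.NumberTheory.PAdicHodge.CyclotomicTilt
import Literature.RingTheory.AdicTopology.TwoGeneratorCompleteness
import HarnessLib

/-!
# `𝔸_inf(F) = 𝕎(𝒪_{ℂ_F}♭)` is complete and separated for the `(p, ξ)`-adic topology

Topic `Literature/NumberTheory/PAdicHodge`; THEOREMS ONLY (no definition, no named fact, no instance,
no `sorry`). For a `p`-adic field `F`, Fontaine's ring `𝔸_inf(F) = 𝕎(𝒪_{ℂ_F}♭)` carries the
`(p, [ϖ])`-adic topology (`ϖ ∈ 𝔪_{ℂ_F}♭ ∖ 0`; Fontaine, *Le corps des périodes p-adiques*, Exp. II §1.3;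
Fontaine–Ouyang §4.4), which is the `(p, ξ)`-adic topology for `ξ = [p♭] − p` (the generator of `ker θ`,
tree `FontaineThetaKernel`). The tree so far only knows that `𝔸_inf` is `p`-adically complete (Mathlib
`WittVector.isAdicCompleteIdealSpanP`) and that the ideals `ξ^k 𝔸_inf` are `p`-adically closed
(`mem_span_xi_pow_of_forall`); every `p`-adic-analytic construction inside `𝔸_inf` beyond the element
`t = log[ε]` (where `[ε] − 1 ∈ ξ𝔸_inf` makes the logarithm `ξ`-adically convergent) — evaluation of
formal-group series at lifts of points of `𝔪_{ℂ_F}`, Fontaine's limits `lim [pⁿ]_𝔉(ûₙ)`, the periods of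
formal groups (Fontaine 1977/1982, Colmez 1992) — needs the full statement proved here:

* §1 (abstract, file `Literature/RingTheory/AdicTopology/TwoGeneratorCompleteness.lean`): for a commutative
  ring `A` and `p t : A`, **`IsAdicComplete (span {p, t}) A`** from (i) `IsAdicComplete (span {p}) A`, (ii)
  `p` a non-zero-divisor, (iii) `t` a non-zero-divisor modulo `p`, (iv)/(v) `A/p` `t`-adically separated
  and complete, phrased inside `A` modulo `span {p}` (`AdicPair.isAdicComplete`; a non-Noetherian
  principal-pair variant of Stacks 0DYC).
* §2 (`𝒪_{ℂ_F}♭`): the inputs (iii)–(v) for `𝔸_inf`: `p♭` is a non-zero-divisor of the domain `𝒪♭`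
  (tree), `⋂ₙ (p♭)ⁿ𝒪♭ = 0` and **`𝒪♭` is `p♭`-adically complete** (`PreTiltComplete.exists_lim_of_sub_mem`):
  `𝒪♭ = lim_{x ↦ x^p} 𝒪_{ℂ_F}/p` and `ker(y ↦ y_j) = (p♭)^{p^j}𝒪♭`
  (tree `exists_eq_pFlat_pow_mul_of_coeff_eq_zero`), so a `p♭`-adic Cauchy sequence has eventually
  constant coefficients, which assemble to its limit; transport to `𝔸_inf` modulo `p` along
  `constantCoeff : 𝕎(𝒪♭) → 𝒪♭` (kernel `p𝕎`, Mathlib `WittVector.mem_span_p_iff_coeff_zero_eq_zero`).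
* §3 (main): **`isAdicComplete_span_p_teichmuller_pFlat : IsAdicComplete (span {p, [p♭]}) 𝔸_inf(F)`**,
  **`isAdicComplete_span_p_xi : IsAdicComplete (span {p, ξ}) 𝔸_inf(F)`** (`span {p, ξ} = span {p, [p♭]}`), and
  **`isAdicComplete_span_xi : IsAdicComplete (span {ξ}) 𝔸_inf(F)`** (`𝔸_inf` is also `ξ`-adically complete:
  `ξⁿ𝔸_inf` is `p`-adically closed, tree `mem_span_xi_pow_of_forall`).
* §4 (the corollary used downstream): an element of `𝔸_inf` whose image under `θ` has some power divisible
  by `p` — e.g. any lift of an element of `𝔪_{ℂ_F}` — is topologically nilpotent for the `(p, ξ)`-adic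
  topology (`pow_mem_span_p_xi_of_fontaineTheta_pow_mem`, `exists_pow_mem_span_p_xi_of_norm_lt_one`): the
  domain of convergence of integral power series (formal group laws, `[p]`-series) on `𝔸_inf`.

## References
* J.-M. Fontaine, *Le corps des périodes p-adiques*, Astérisque 223 (1994), Exp. II §1.3 (topologie de
  `A_inf`: séparé et complet pour la topologie `(p, [ϖ])`-adique). [FontaineAsterisque223III]
* J.-M. Fontaine, Y. Ouyang, *Theory of p-adic Galois representations*, §4.4. [FontaineOuyang2022]
* B. Bhatt, M. Morrow, P. Scholze, *Integral p-adic Hodge theory*, Publ. IHÉS 129 (2019), §3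
  (`A_inf` is `(p, ξ)`-adically complete). [BhattMorrowScholze2019]
-/

noncomputable section

open Ideal WittVector

namespace Literature.NumberTheory.PAdicHodge

/-! §1 (the abstract two-generator criterion) is `Literature/RingTheory/AdicTopology/TwoGeneratorCompleteness.lean`
(`Literature.RingTheory.AdicTopology.AdicPair.isAdicComplete`). -/

open Literature.RingTheory.AdicTopology

/-! ## §2 `𝒪_{ℂ_F}♭` is `p♭`-adically complete and separated; transport to `𝔸_inf` modulo `p` -/

open Literature.NumberTheory.GaloisRepresentations
open Literature.NumberTheory.GaloisRepresentations.IsNonarchimedeanLocalField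

variable {F : Type} [Field F] [ValuativeRel F] [TopologicalSpace F] [IsNonarchimedeanLocalField F]
  [CharZero F] {p : ℕ} [Fact p.Prime] [Fact (¬ IsUnit (p : integerC F))]

namespace PreTiltComplete

omit [CharZero F] in
/-- `(y_j)^{p^j} = y_0` for the coefficients of an element of the tilt `lim_{x ↦ x^p} 𝒪/p`.
[cite: FontaineOuyang2022, §4.3] -/
theorem coeff_pow_prime_pow (x : PreTilt (integerC F) p) (j : ℕ) :
    PreTilt.coeff j x ^ p ^ j = PreTilt.coeff 0 x := by
  induction j with
  | zero => rw [pow_zero, pow_one]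
  | succ j ih => rw [pow_succ', pow_mul, PreTilt.coeff_pow_p, ih]

omit [CharZero F] in
/-- The `j`-th coefficient of a multiple of `(p♭)^{p^j}` vanishes. [cite: FontaineOuyang2022, Prop. 4.3.3] -/
theorem coeff_eq_zero_of_mem_span_pFlat_pow {x : PreTilt (integerC F) p} {j n : ℕ} (hn : p ^ j ≤ n)
    (hx : x ∈ Ideal.span {(pFlat : PreTilt (integerC F) p) ^ n}) : PreTilt.coeff j x = 0 := by
  obtain ⟨c, rfl⟩ := Ideal.mem_span_singleton'.1 hx
  obtain ⟨m, rfl⟩ := Nat.exists_eq_add_of_le hn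
  rw [map_mul, pow_add, map_mul, map_pow, coeff_pow_prime_pow, coeff_zero_pFlat, zero_mul, mul_zero]

omit [CharZero F] in
/-- **`𝒪_{ℂ_F}♭` is `p♭`-adically separated**: `⋂ₙ (p♭)ⁿ 𝒪♭ = 0`. [cite: FontaineOuyang2022, §4.3] -/
theorem eq_zero_of_forall_mem_span_pFlat_pow {x : PreTilt (integerC F) p}
    (hx : ∀ n : ℕ, x ∈ Ideal.span {(pFlat : PreTilt (integerC F) p) ^ n}) : x = 0 := by
  refine Perfection.ext fun j => ?_
  change PreTilt.coeff j x = PreTilt.coeff j 0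
  rw [map_zero]
  exact coeff_eq_zero_of_mem_span_pFlat_pow le_rfl (hx (p ^ j))

/-- **`𝒪_{ℂ_F}♭` is `p♭`-adically complete**: a sequence with `f(n+1) − f(n) ∈ (p♭)^{n+1}` has a limit
`l` with `l − f(n) ∈ (p♭)^{n+1}` — the coefficients of `f(n)` are eventually constant (`ker(y ↦ y_j) =
(p♭)^{p^j}`) and assemble to `l`. [cite: FontaineAsterisque223III, Exp. II §1.2.2–§1.3] [cite: FontaineOuyang2022, §4.3] -/
theorem exists_lim_of_sub_mem [IsAdicComplete (Ideal.span {(p : integerC F)}) (integerC F)]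
    (f : ℕ → PreTilt (integerC F) p)
    (hf : ∀ n, f (n + 1) - f n ∈ Ideal.span {(pFlat : PreTilt (integerC F) p) ^ (n + 1)}) :
    ∃ l : PreTilt (integerC F) p, ∀ n, l - f n ∈ Ideal.span {(pFlat : PreTilt (integerC F) p) ^ (n + 1)} := by
  have hanti : Antitone fun k : ℕ => Ideal.span {(pFlat : PreTilt (integerC F) p) ^ (k + 1)} :=
    fun a b hab => Ideal.span_singleton_le_span_singleton.2 (pow_dvd_pow _ (Nat.succ_le_succ hab))
  have htel : ∀ {m n : ℕ}, m ≤ n → f n - f m ∈ Ideal.span {(pFlat : PreTilt (integerC F) p) ^ (m + 1)} :=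
    fun hmn => AdicPair.sub_mem_of_forall_sub_mem hanti f hf hmn
  -- the coefficients stabilise: `c j = (f (p^j))_j`
  let c : ℕ → ModP (integerC F) p := fun j => PreTilt.coeff j (f (p ^ j))
  have hstab : ∀ {j n : ℕ}, p ^ j ≤ n → PreTilt.coeff j (f n) = c j := by
    intro j n hn
    have h := coeff_eq_zero_of_mem_span_pFlat_pow (Nat.le_succ _) (htel hn)
    rwa [map_sub, sub_eq_zero] at h
  have hc : ∀ j, c (j + 1) ^ p = c j := by
    intro j
    change PreTilt.coeff (j + 1) (f (p ^ (j + 1))) ^ p = _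
    rw [PreTilt.coeff_pow_p, hstab (Nat.pow_le_pow_right (Fact.out : p.Prime).pos (Nat.le_succ j))]
  let l : PreTilt (integerC F) p := ⟨c, hc⟩
  have hl : ∀ j, PreTilt.coeff j l = c j := fun j => rfl
  refine ⟨l, fun n => ?_⟩
  -- `l − f(p^j) ∈ (p♭)^{p^j}` for `p^j ≥ n + 1`, and `f(p^j) − f(n) ∈ (p♭)^{n+1}`
  have hj : n + 1 ≤ p ^ (n + 1) := (Nat.lt_pow_self (Fact.out : p.Prime).one_lt).le
  have h1 : PreTilt.coeff (n + 1) (l - f (p ^ (n + 1))) = 0 := by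
    rw [map_sub, hl, hstab le_rfl, sub_self]
  obtain ⟨w, hw⟩ := GaloisContinuity.exists_eq_pFlat_pow_mul_of_coeff_eq_zero h1
  have h2 : l - f (p ^ (n + 1)) ∈ Ideal.span {(pFlat : PreTilt (integerC F) p) ^ (n + 1)} := by
    rw [hw]
    exact Ideal.mul_mem_right _ _ (Ideal.span_singleton_le_span_singleton.2 (pow_dvd_pow _ hj)
      (Ideal.mem_span_singleton_self _))
  have h3 : f (p ^ (n + 1)) - f n ∈ Ideal.span {(pFlat : PreTilt (integerC F) p) ^ (n + 1)} :=
    htel ((Nat.le_succ n).trans hj)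
  have : l - f n = (l - f (p ^ (n + 1))) + (f (p ^ (n + 1)) - f n) := by ring
  rw [this]
  exact Submodule.add_mem _ h2 h3

end PreTiltComplete

namespace AinfComplete

/-- `[p♭] x ∈ p𝔸_inf ⇒ x ∈ p𝔸_inf` (`p♭` is a non-zero-divisor of the domain `𝒪♭ = 𝔸_inf/p`).
[cite: FontaineOuyang2022, Prop. 4.4.3] -/
theorem mem_span_p_of_teichmuller_mul_mem {x : Ainf (p := p) F}
    (h : teichmuller p (pFlat : PreTilt (integerC F) p) * x ∈ Ideal.span {(p : Ainf (p := p) F)}) :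
    x ∈ Ideal.span {(p : Ainf (p := p) F)} := by
  rw [mem_span_p_iff_coeff_zero_eq_zero] at h ⊢
  rw [← constantCoeff_apply, map_mul, constantCoeff_apply, teichmuller_coeff_zero, constantCoeff_apply] at h
  exact eq_zero_of_pFlat_mul_eq_zero h

omit [CharZero F] in
/-- Transport modulo `p`: `x ∈ ([p♭]ⁿ) + (p)` iff `x₀ ∈ (p♭)ⁿ` in `𝒪♭ = 𝔸_inf/p` (`𝕎(𝒪♭)/p = 𝒪♭` via the
`0`-th Witt coordinate). [cite: FontaineOuyang2022, §4.4] -/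
theorem mem_sup_iff_constantCoeff_mem (x : Ainf (p := p) F) (n : ℕ) :
    x ∈ Ideal.span {teichmuller p (pFlat : PreTilt (integerC F) p) ^ n} ⊔ Ideal.span {(p : Ainf (p := p) F)} ↔
      constantCoeff x ∈ Ideal.span {(pFlat : PreTilt (integerC F) p) ^ n} := by
  constructor
  · rintro h
    obtain ⟨a, ha, b, hb, rfl⟩ := Submodule.mem_sup.1 h
    obtain ⟨a', rfl⟩ := Ideal.mem_span_singleton'.1 ha
    rw [mem_span_p_iff_coeff_zero_eq_zero] at hb
    simp only [map_add, map_mul, map_pow, constantCoeff_apply, teichmuller_coeff_zero, hb, add_zero]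
    exact Ideal.mul_mem_left _ _ (Ideal.mem_span_singleton_self _)
  · intro h
    obtain ⟨c, hc⟩ := Ideal.mem_span_singleton'.1 h
    refine Submodule.mem_sup.2 ⟨teichmuller p c * teichmuller p pFlat ^ n,
      Ideal.mul_mem_left _ _ (Ideal.mem_span_singleton_self _), x - teichmuller p c * teichmuller p pFlat ^ n,
      ?_, by ring⟩
    rw [mem_span_p_iff_coeff_zero_eq_zero, ← constantCoeff_apply, map_sub, map_mul, map_pow,
      constantCoeff_apply (teichmuller p c), teichmuller_coeff_zero, constantCoeff_apply (teichmuller p pFlat),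
      teichmuller_coeff_zero, hc, sub_self]

end AinfComplete

/-! ## §3 `𝔸_inf(F)` is `(p, [p♭])` = `(p, ξ)`-adically complete and separated; `ξ`-adic completeness -/

open AinfComplete in
/-- **`𝔸_inf(F)` is complete and separated for the `(p, [p♭])`-adic topology.**
[cite: FontaineAsterisque223III, Exp. II §1.3.2] [cite: FontaineOuyang2022, §4.4] -/
theorem isAdicComplete_span_p_teichmuller_pFlat [IsAdicComplete (Ideal.span {(p : integerC F)}) (integerC F)] :
    IsAdicComplete (Ideal.span {(p : Ainf (p := p) F), teichmuller p (pFlat : PreTilt (integerC F) p)})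
      (Ainf (p := p) F) := by
  refine AdicPair.isAdicComplete (fun x hx => eq_zero_of_p_mul_eq_zero x (by rwa [mul_comm]))
    (fun x hx => mem_span_p_of_teichmuller_mul_mem hx) (fun x hx => ?_) (fun f hf => ?_)
  · -- separatedness of `𝒪♭`
    rw [mem_span_p_iff_coeff_zero_eq_zero, ← constantCoeff_apply]
    exact PreTiltComplete.eq_zero_of_forall_mem_span_pFlat_pow fun n => (mem_sup_iff_constantCoeff_mem x n).1 (hx n)
  · -- completeness of `𝒪♭`
    obtain ⟨l, hl⟩ := PreTiltComplete.exists_lim_of_sub_mem (fun n => constantCoeff (f n)) fun n => by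
      rw [← map_sub]; exact (mem_sup_iff_constantCoeff_mem _ _).1 (hf n)
    refine ⟨teichmuller p l, fun n => (mem_sup_iff_constantCoeff_mem _ _).2 ?_⟩
    rw [map_sub, constantCoeff_apply (teichmuller p l), teichmuller_coeff_zero]
    exact hl n

omit [CharZero F] in
/-- `(p, ξ) = (p, [p♭])` as ideals of `𝔸_inf` (`ξ = [p♭] − p`): the `(p, ξ)`-adic and `(p, [ϖ])`-adic topologies
agree. [cite: FontaineAsterisque223III, Exp. II §1.3] -/
theorem span_p_xi_eq :
    Ideal.span {(p : Ainf (p := p) F), xi} = Ideal.span {(p : Ainf (p := p) F), teichmuller p pFlat} := by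
  apply le_antisymm <;> rw [Ideal.span_le] <;> rintro y hy <;>
    simp only [Set.mem_insert_iff, Set.mem_singleton_iff] at hy <;> rcases hy with rfl | rfl
  · exact Ideal.subset_span (by simp)
  · rw [SetLike.mem_coe, xi_def]
    exact Submodule.sub_mem _ (Ideal.subset_span (by simp)) (Ideal.subset_span (by simp))
  · exact Ideal.subset_span (by simp)
  · rw [SetLike.mem_coe, show teichmuller p (pFlat : PreTilt (integerC F) p) = xi + (p : Ainf (p := p) F) by
      rw [xi_def, sub_add_cancel]]
    exact Submodule.add_mem _ (Ideal.subset_span (by simp)) (Ideal.subset_span (by simp))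

/-- **`𝔸_inf(F)` is complete and separated for the `(p, ξ)`-adic topology** (`ξ = [p♭] − p` the generator
of `ker θ`). [cite: FontaineAsterisque223III, Exp. II §1.3.2] [cite: BhattMorrowScholze2019, §3] -/
theorem isAdicComplete_span_p_xi [IsAdicComplete (Ideal.span {(p : integerC F)}) (integerC F)] :
    IsAdicComplete (Ideal.span {(p : Ainf (p := p) F), xi}) (Ainf (p := p) F) := by
  rw [span_p_xi_eq]
  exact isAdicComplete_span_p_teichmuller_pFlat

omit [CharZero F] in
/-- `(p, ξ)^{a+b} ⊆ (p^a) + (ξ^b)` (the `(p,ξ)`-adic topology has the basis `p^a𝔸_inf + ξ^b𝔸_inf`).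
[cite: FontaineAsterisque223III, Exp. II §1.3] -/
theorem span_p_xi_pow_le (a b : ℕ) :
    Ideal.span {(p : Ainf (p := p) F), xi} ^ (a + b) ≤
      Ideal.span {(p : Ainf (p := p) F) ^ a} ⊔ Ideal.span {(xi : Ainf (p := p) F) ^ b} := by
  rw [Ideal.span_insert, ← Ideal.span_singleton_pow, ← Ideal.span_singleton_pow]
  exact Ideal.sup_pow_add_le_pow_sup_pow

/-- **`𝔸_inf(F)` is `ξ`-adically complete and separated.** Separatedness: `⋂ ξⁿ𝔸_inf ⊆ ⋂ (p,ξ)ⁿ = 0`;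
completeness: a `ξ`-adic Cauchy sequence is `(p, ξ)`-adically Cauchy, and its `(p,ξ)`-adic limit is a
`ξ`-adic limit because `ξⁿ𝔸_inf` is `p`-adically closed (`mem_span_xi_pow_of_forall`).
[cite: FontaineAsterisque223III, Exp. II §1.3] [cite: BhattMorrowScholze2019, §3] -/
theorem isAdicComplete_span_xi [IsAdicComplete (Ideal.span {(p : integerC F)}) (integerC F)] :
    IsAdicComplete (Ideal.span {(xi : Ainf (p := p) F)}) (Ainf (p := p) F) := by
  haveI := isAdicComplete_span_p_xi (F := F) (p := p)
  have hle : Ideal.span {(xi : Ainf (p := p) F)} ≤ Ideal.span {(p : Ainf (p := p) F), xi} :=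
    Ideal.span_mono (by simp)
  haveI : IsHausdorff (Ideal.span {(xi : Ainf (p := p) F)}) (Ainf (p := p) F) := by
    refine ⟨fun x hx => ?_⟩
    refine IsHausdorff.haus (IsAdicComplete.toIsHausdorff (I := Ideal.span {(p : Ainf (p := p) F), xi})) x
      fun n => ?_
    have h := hx n
    rw [smul_eq_mul, Ideal.mul_top, SModEq.zero] at h ⊢
    exact Ideal.pow_right_mono hle n h
  haveI : IsPrecomplete (Ideal.span {(xi : Ainf (p := p) F)}) (Ainf (p := p) F) := by
    refine ⟨fun f hf => ?_⟩
    -- the `(p, ξ)`-adic limit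
    have hf' : ∀ {m n : ℕ}, m ≤ n → f m ≡ f n [SMOD (Ideal.span {(p : Ainf (p := p) F), xi} ^ m • ⊤ :
        Submodule (Ainf (p := p) F) (Ainf (p := p) F))] := by
      intro m n hmn
      have h := hf hmn
      rw [smul_eq_mul, Ideal.mul_top, SModEq.sub_mem] at h ⊢
      exact Ideal.pow_right_mono hle m h
    obtain ⟨L, hL⟩ := IsPrecomplete.prec
      (IsAdicComplete.toIsPrecomplete (I := Ideal.span {(p : Ainf (p := p) F), xi})) hf'
    refine ⟨L, fun n => ?_⟩
    rw [smul_eq_mul, Ideal.mul_top, SModEq.sub_mem, Ideal.span_singleton_pow]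
    -- `f n − L ∈ (ξⁿ) + (p^a)` for every `a`
    refine mem_span_xi_pow_of_forall n fun a => ?_
    have h1 : f n - f (a + n) ∈ Ideal.span {(xi : Ainf (p := p) F) ^ n} := by
      have h := hf (Nat.le_add_left n a)
      rwa [smul_eq_mul, Ideal.mul_top, SModEq.sub_mem, Ideal.span_singleton_pow] at h
    have h2 : f (a + n) - L ∈ Ideal.span {(p : Ainf (p := p) F) ^ a} ⊔ Ideal.span {(xi : Ainf (p := p) F) ^ n} := by
      have h := hL (a + n)
      rw [smul_eq_mul, Ideal.mul_top, SModEq.sub_mem] at h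
      exact span_p_xi_pow_le a n h
    obtain ⟨c, hc⟩ := Ideal.mem_span_singleton'.1 h1
    obtain ⟨u, hu, v, hv, huv⟩ := Submodule.mem_sup.1 h2
    obtain ⟨d, rfl⟩ := Ideal.mem_span_singleton'.1 hu
    obtain ⟨e, rfl⟩ := Ideal.mem_span_singleton'.1 hv
    refine ⟨c + e, d, ?_⟩
    have : f n - L = (f n - f (a + n)) + (f (a + n) - L) := by ring
    rw [this, ← hc, ← huv]
    ring
  exact ⟨⟩

/-! ## §4 Lifts of topologically nilpotent elements of `𝒪_{ℂ_F}` are `(p, ξ)`-adically topologically nilpotent -/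

/-- If `θ(a)^N ∈ p𝒪_{ℂ_F}` then `a^N ∈ (p, ξ)` (`ker θ = ξ𝔸_inf`). [cite: FontaineAsterisque223III, Exp. II §1.2–§1.3] -/
theorem pow_mem_span_p_xi_of_fontaineTheta_pow_mem [IsAdicComplete (Ideal.span {(p : integerC F)}) (integerC F)]
    (hF : Function.Surjective (fontaineTheta (integerC F) p)) {a : Ainf (p := p) F} {N : ℕ}
    (h : fontaineTheta (integerC F) p a ^ N ∈ Ideal.span {(p : integerC F)}) :
    a ^ N ∈ Ideal.span {(p : Ainf (p := p) F), xi} := by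
  obtain ⟨b, hb⟩ := Ideal.mem_span_singleton'.1 h
  obtain ⟨c, rfl⟩ := hF b
  have hker : a ^ N - c * (p : Ainf (p := p) F) ∈ RingHom.ker (fontaineTheta (integerC F) p) := by
    rw [RingHom.mem_ker, map_sub, map_mul, map_natCast, map_pow, hb, sub_self]
  rw [ker_fontaineTheta_eq_span_xi] at hker
  have : a ^ N = (a ^ N - c * (p : Ainf (p := p) F)) + c * (p : Ainf (p := p) F) := by ring
  rw [this]
  exact Submodule.add_mem _ (Ideal.span_mono (by simp) hker)
    (Ideal.mul_mem_left _ _ (Ideal.subset_span (by simp)))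

/-- **Topological nilpotence of lifts of `𝔪_{ℂ_F}`**: if `‖θ(a)‖ < 1` then `a^N ∈ (p, ξ)` for some `N` — so
`a` is topologically nilpotent for the `(p, ξ)`-adic topology of `𝔸_inf(F)`, the convergence condition for
evaluating integral power series at `a`. [cite: FontaineAsterisque223III, Exp. II §1.3] -/
theorem exists_pow_mem_span_p_xi_of_norm_lt_one [IsAdicComplete (Ideal.span {(p : integerC F)}) (integerC F)]
    (hF : Function.Surjective (fontaineTheta (integerC F) p)) {a : Ainf (p := p) F}
    (ha : ‖((fontaineTheta (integerC F) p a : integerC F) : CompletedAlgClosure F)‖ < 1) :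
    ∃ N : ℕ, a ^ N ∈ Ideal.span {(p : Ainf (p := p) F), xi} := by
  have hp0 : ((p : integerC F) : CompletedAlgClosure F) ≠ 0 := by
    rw [coe_natCast_integerC]; exact natCast_C_ne_zero (Fact.out : p.Prime).ne_zero
  obtain ⟨N, hN⟩ := exists_pow_lt_of_lt_one (norm_pos_iff.2 hp0) ha
  refine ⟨N, pow_mem_span_p_xi_of_fontaineTheta_pow_mem hF ?_⟩
  rw [← pow_one (Ideal.span {(p : integerC F)}), mem_span_pow_iff hp0 1, pow_one, Subring.coe_pow, norm_pow]
  exact hN.le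

end Literature.NumberTheory.PAdicHodge

end
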